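import Summits.QuantumFields.YangMills.Theorems.BalabanUVNodesN15KingModelB9Thm31AllAtTrivialU
import Summits.QuantumFields.YangMills.Theorems.BalabanUVNodesN15TwoGridLandauMassless
import Summits.QuantumFields.YangMills.Theorems.BalabanUVNodesN15CovariantLandauFlat
import Summits.QuantumFields.YangMills.Theorems.BalabanUVNodesN15VectorPieceBackgroundMatrix
import Summits.QuantumFields.YangMills.Theorems.BalabanUVNodesN15SiteScalarLayerMassless
import HarnessLib

/-!
# Route «BalabanUVNodes», node N15 = NE2, road (c) — PROGRAMME (P-S), X: THE THREE FLAT KERNEL ROWS OF THE LANDAU LETTER's PRIMITIVE FAMILY — `G′(1)`, `∂G′(1)`, `G′(1)∂ᵀ` — PROVED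
# ON KING's TORUS FAMILY FROM THE KING-MODEL RUNG (dag-n15-e `fullPropOp∕DOp∕AdjOp_sup_decay`, uniform in `K`, the volume and the mass) at the mass `a = a_K·n^{d+1}`, passed to
# `m² = 0` by continuity (dag-n15-a `TwoGridLandauMassless` device) and lifted to the coloured carriers (dag-n15-c g23, n15-c∕220)

Cell `pub-ymgap`, seat `pub-ymgap-dag-n15-c` (generation g23; R134 (a), s1; HUMAN RULING D-0062; chair R424 venue).  `bears_on: R4∕N15 · K3⁸ SpineGivenEndpointR13SepCoPHV
(stmt-QuantumFields-27366)`; filed `--supports stmt-QuantumFields-27366 --as helper` — COUNT-NEUTRAL.  Theorems only; 0 `sorry`; HYPOTHESIS-FREE on King's torus family `M_μ = 2L^e`, `n = L^K`,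
`K ≥ 1`, `L` odd `≥ 2`, `a₀ > 0`.  Imports BY NAME dag-n15-e `…KingModelB9Thm31AllAtTrivialU` (`N15KingModelRung.Curved.fullPropOp_sup_decay`, `fullPropDOp_sup_decay`, `fullPropAdjOp_sup_decay`:
[Balaban1983RegularityDecay] Theorem (1.10) ∕ [B9] (3.42) entries 0–2 at `U ≡ 1` in King's spelling, kernel-checked), dag-n15-a `…TwoGridLandauMassless` (`abs_le_of_Ioc`), this seat's g7 `…SiteScalarLayerMassless` (`continuousAt_fineOp_inv_mulVec_mass`) + `…TwoGridLandauGreenDict` (`reM_greenOp_eq_fineOp`), n15-c∕200 `…CovariantLandauFlat` (`lapAFlat_eq_reM`, `mulVecLin_kronecker_one`; through it 197 `cGreen_one`, `cgrad_one`,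
`gradFlat_apply`), n15-c M4 `…VectorPieceBackgroundMatrix` (`VectorPiece.hasMaj_tensorId`).  Nothing in the tree is modified.

WHY.  n15-c∕219 `ne2PlusOperator_sfqr_of_flatRows(_mass)` displays, per grid, the four FLAT rows of the primitive family at the mass `a_w·n^{d+1}`.  The model's flat operator IS King's:
`Δ′_a(1) = ∂ᵀ∂ + a_w n^{d+1}·Q′ᵀQ′ = N²(−Δ) + a_w·P₀ = fineOp n M a_w n² 0` (n15-c∕200 `lapAFlat_eq_reM` + dag-n15-a part 50 `reM_greenOp_eq_fineOp`), so the King-model rung's sup-norm decay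
theorems — PROVED in the tree for King's full `A = 0` propagator `(fineOp N M a_K N² m²)⁻¹` on the tori `2L^e`, uniformly in `K`, `e` and `m² ∈ (0, m₀²]` — give the flat rows of `G′(1)`,
`∂G′(1)`, `G′(1)∂ᵀ` at `a_w = a_K(a₀, L, K) ∈ (0, a₀]` once `m² → 0⁺` (the inverse is continuous at the invertible massless operator) and once the scalar rows are tensored with `1_ι`.
THIS FILE does exactly that: THREE of the four flat rows of n15-c∕219 become theorems on the cover's tori (`cvM = 2L^{m+1}`, `n = L^{kk}`, `L^r·L^{kk}`); the fourth (`(Q′G′²Q′ᵀ)⁻¹(1)`,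
[Balaban1984PropagatorsII] Prop. 2.3) is not in the rung and stays displayed.
* §1 dictionary: `lapAFlat_eq_fineOp`, `greenFlat_eq_fineOp_inv`, `gradFlat_transpose_mulVec`, `mulVecLin_kronecker_one_rect` (the mass continuity is this seat's g7 `SiteLayerBg.continuousAt_fineOp_inv_mulVec_mass`).
* §2 ★★★ **`flatKernelRows_king`** — `∃ C δ > 0 ∀ K ≥ 1 ∀ N = L^K ∀ e, M = 2L^e ∀ k ι`: the three coloured rows `G′(1) ≤ Ce^{−δd}` (BS → BS), `∂G′(1) ≤ Ce^{−δd}` (BS → BV), `G′(1)∂ᵀ ≤ Ce^{−δd}`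
  (BV → BS) at the mass `a_K·N^{d+1}`, in the currency of n15-c∕214–219.

HONEST FRAMING ∕ LIMITS.  The rows are King's `A = 0` MODEL statements ([King1986] template literature) read on Bałaban's flat objects at `U ≡ 1` through an exact dictionary; periodic b.c.,
`K ≥ 1`, tori `2L^e`; NOT [Balaban1985BackgroundPropagators] Thm 3.1 as printed (covariant, multiscale); NE2⁺ NOT PRINTED; N15 of record untouched (DISCHARGED AS CONSUMED, p687738); counts
UNMOVED (typed 28∕28 · discharged 8∕27); one finite 𝕋⁴ at fixed ε per index — NOT infinite volume ∕ OS ∕ mass gap ∕ Clay.  Restate-immune (no Theses import).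
-/

noncomputable section

open scoped BigOperators Matrix Kronecker

namespace Summit.QuantumFields.YangMills.BalabanUVNodes.N15.CovLandau

open Literature.MathematicalPhysics.QuantumFieldTheory.Balaban1983to89
open Literature.MathematicalPhysics.QuantumFieldTheory.Balaban1983to89.B5Prop11Plancherel (Tor fine unitVec)
open Literature.MathematicalPhysics.QuantumFieldTheory.Balaban1983to89.B11SectG (BlockNorm HasMaj)
open Literature.MathematicalPhysics.QuantumFieldTheory.Balaban1983to89.B11AxialTransport190 (abs_le_loc_ofBlocks loc_ofBlocks_le)
open Literature.MathematicalPhysics.QuantumFieldTheory.Balaban1983to89.B6UnitTorusCarrier (unitTorusGeo)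
open Literature.MathematicalPhysics.QuantumFieldTheory.Balaban1983to89.B5Hk160Torus (QsAdj)
open Summit.QuantumFields.BalabanUV.T4Continuum.ScalarAveragedPropagator (DeltaPs)
open Summit.QuantumFields.BalabanUV.T4Continuum.ScalarBlockPoincare (PiS)
open Literature.MathematicalPhysics.QuantumFieldTheory.King1986 (aK aK_pos aK_le)
open Literature.MathematicalPhysics.QuantumFieldTheory.King1986.Torus (blockOf tdistT tdistT_nonneg fineOp)
open Summit.QuantumFields.YangMills.BalabanUVNodes.N15.VectorPiece (tensorId tensorId_apply hasMaj_tensorId)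
open Summit.QuantumFields.YangMills.BalabanUVNodes.N15.MatrixSpecies (liftBlk)
open Summit.QuantumFields.YangMills.BalabanUVNodes.N15.TwoGrid (reM_greenOp_eq_fineOp abs_le_of_Ioc)
open Summit.QuantumFields.YangMills.BalabanUVNodes.N15.SiteLayerBg (continuousAt_fineOp_inv_mulVec_mass)
open Summit.QuantumFields.YangMills.BalabanUVNodes.N15KingModelRung.Curved (fullPropOp_sup_decay fullPropDOp_sup_decay fullPropAdjOp_sup_decay)

variable {d : ℕ}

/-! ## §1 The dictionary `Δ′_a(1) = fineOp`, the transposed gradient, Kronecker lifts, continuity in the mass -/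

section Dict

variable (M : Fin (d + 1) → ℕ) [∀ μ, NeZero (M μ)] (n : ℕ) [NeZero n]

/-- ★ **THE MODEL's FLAT `Δ′_a` AT `a = a′·n^{d+1}` IS KING's `fineOp n M a′ n² 0`** (`∂ᵀ∂ = N²(−Δ)`, `a′n^{d+1}Q′ᵀQ′ = a′·P₀`). [cite: King1986, (4.1)–(4.5) p.670; Balaban1985BackgroundPropagators, (3.24) p.394 (at `U ≡ 1`)] -/
theorem lapAFlat_eq_fineOp (a' : ℝ) : lapAFlat M n (a' * (n : ℝ) ^ (d + 1)) = fineOp n M a' ((n : ℝ) ^ 2) 0 := by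
  rw [lapAFlat_eq_reM, ← reM_greenOp_eq_fineOp]
  congr 1
  rw [DeltaPs, PiS, QsAdj, Matrix.smul_mul]

/-- `G′(1) = (fineOp n M a′ n² 0)⁻¹` at `a = a′·n^{d+1}`. [cite: King1986, (4.5) p.670] -/
theorem greenFlat_eq_fineOp_inv (a' : ℝ) : greenFlat M n (a' * (n : ℝ) ^ (d + 1)) = (fineOp n M a' ((n : ℝ) ^ 2) 0)⁻¹ := by
  rw [greenFlat, lapAFlat_eq_fineOp]

/-- The transposed flat gradient is the backward divergence: `(∂ᵀω)(z) = Σ_ν n·(ω(z − e_ν, ν) − ω(z, ν))`. [cite: Balaban1984PropagatorsI, (1.4) p.18] -/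
theorem gradFlat_transpose_mulVec (ω : Tor (fine n M) × Fin (d + 1) → ℝ) (z : Tor (fine n M)) :
    ((gradFlat M n)ᵀ *ᵥ ω) z = ∑ ν, (n : ℝ) * (ω (z - unitVec (fine n M) ν, ν) - ω (z, ν)) := by
  rw [Matrix.mulVec, dotProduct, Fintype.sum_prod_type, Finset.sum_comm]
  refine Finset.sum_congr rfl fun ν _ => ?_
  simp only [Matrix.transpose_apply, gradFlat_apply]
  have h1 : ∀ y : Tor (fine n M), (if z = y + unitVec (fine n M) ν then (1 : ℝ) else 0) = if y = z - unitVec (fine n M) ν then 1 else 0 := fun y => by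
    by_cases h : y = z - unitVec (fine n M) ν
    · rw [if_pos h, if_pos (by rw [h, sub_add_cancel])]
    · rw [if_neg h, if_neg (fun h' => h (by rw [h', add_sub_cancel_right]))]
  simp_rw [h1]
  rw [show (∑ y : Tor (fine n M), (n : ℝ) * ((if y = z - unitVec (fine n M) ν then (1 : ℝ) else 0) - (if y = z then 1 else 0)) * ω (y, ν)) =
      ∑ y : Tor (fine n M), ((if y = z - unitVec (fine n M) ν then (n : ℝ) * ω (y, ν) else 0) - (if y = z then (n : ℝ) * ω (y, ν) else 0)) from
    Finset.sum_congr rfl fun y _ => by split_ifs <;> ring]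
  rw [Finset.sum_sub_distrib, Finset.sum_ite_eq' Finset.univ, Finset.sum_ite_eq' Finset.univ]
  simp only [Finset.mem_univ, if_true]
  ring

omit [∀ μ, NeZero (M μ)] [NeZero n] in
/-- Kronecker lift with `1_ι` of a RECTANGULAR real matrix is the componentwise operator. [folklore] -/
theorem mulVecLin_kronecker_one_rect {X X₂ : Type} [Fintype X] [DecidableEq X] [Fintype X₂] [DecidableEq X₂] {ι : Type} [Fintype ι] [DecidableEq ι] (A : Matrix X₂ X ℝ) :
    Matrix.mulVecLin (A ⊗ₖ (1 : Matrix ι ι ℝ)) = tensorId ι (Matrix.mulVecLin A) := by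
  refine LinearMap.ext fun f => funext fun ⟨x, i⟩ => ?_
  rw [Matrix.mulVecLin_apply, tensorId_apply, Matrix.mulVecLin_apply]
  simp only [Matrix.mulVec, dotProduct, Fintype.sum_prod_type, Matrix.kroneckerMap_apply, Matrix.one_apply, mul_ite, mul_one, mul_zero, ite_mul, zero_mul,
    Finset.sum_ite_eq, Finset.mem_univ, if_true]

end Dict

/-! ## §2 The three flat kernel rows from the King-model rung -/

section Rows

variable (L : ℕ) [NeZero L]

omit [NeZero L] in
/-- From King's `(D, F)`-decay statement to a sharp-block majorant: the block of the observation point and the block of the source are at distance `D = |y − y′|_T`. [folklore] -/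
theorem hasMaj_of_kingDecay {M : Fin (d + 1) → ℕ} [∀ μ, NeZero (M μ)] (k : ℕ) {X₁ X₂ : Type} [Fintype X₁] [Fintype X₂] (blk₁ : X₁ → Tor M) (blk₂ : X₂ → Tor M)
    (T : (X₁ → ℝ) →ₗ[ℝ] (X₂ → ℝ)) {C δ : ℝ} (hC : 0 ≤ C)
    (h : ∀ (lam : X₁ → ℝ) (F D : ℝ), (∀ y, |lam y| ≤ F) → ∀ x₂ : X₂, (∀ y, lam y ≠ 0 → D ≤ tdistT M (blk₂ x₂) (blk₁ y)) → |T lam x₂| ≤ C * Real.exp (-(δ * D)) * F) :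
    HasMaj (BlockNorm.ofBlocks (unitTorusGeo L k M) blk₁) (BlockNorm.ofBlocks (unitTorusGeo L k M) blk₂) T (fun y y' => C * Real.exp (-(δ * tdistT M y y'))) := by
  intro y' lam hlam y
  have hlam' : ∀ z, blk₁ z ≠ y' → lam z = 0 := hlam
  have hL0 := (BlockNorm.ofBlocks (unitTorusGeo L k M) blk₁).loc_nonneg y' lam
  have hF : ∀ z, |lam z| ≤ (BlockNorm.ofBlocks (unitTorusGeo L k M) blk₁).loc y' lam := by
    intro z
    by_cases hz : blk₁ z = y'
    · exact abs_le_loc_ofBlocks (g := unitTorusGeo L k M) blk₁ lam hz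
    · rw [hlam' z hz, abs_zero]; exact hL0
  refine loc_ofBlocks_le (g := unitTorusGeo L k M) blk₂ _ (mul_nonneg (mul_nonneg hC (Real.exp_nonneg _)) hL0) fun x₂ hx₂ => ?_
  refine h lam _ (tdistT M y y') hF x₂ fun z hz => le_of_eq ?_
  have hzb : blk₁ z = y' := by by_contra hne; exact hz (hlam' z hne)
  rw [hx₂, hzb]

/-- ★★★ **THE THREE FLAT KERNEL ROWS FROM THE KING-MODEL RUNG, HYPOTHESIS-FREE ON KING's TORUS FAMILY.**  For odd `L ≥ 2` and `a₀ > 0` there are `C, δ > 0` such that for every `K ≥ 1`,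
`N = L^K`, every torus `M_μ = 2L^e`, every geometry label `k` and colour type `ι`, at the mass `a = a_K(a₀, L, K)·N^{d+1}` (`0 < a_K ≤ a₀`): `G′(1) ≤ C·e^{−δ|y−y′|_T}` (BS → BS),
`∂G′(1) ≤ C·e^{−δ|y−y′|_T}` (BS → BV), `G′(1)∂ᵀ ≤ C·e^{−δ|y−y′|_T}` (BV → BS) — dag-n15-e's `fullPropOp∕DOp∕AdjOp_sup_decay` at `m² → 0⁺`, read through §1.
[cite: King1986, Thm 3.3 (3.7)–(3.8) p.656, (4.5) p.670; Balaban1983RegularityDecay, Theorem (1.10) p.573; Balaban1985BackgroundPropagators, Thm 3.1 (3.42) p.397 (entries 0–2 at `U ≡ 1`: shape)] -/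
theorem flatKernelRows_king (hLodd : Odd L) (hL : 2 ≤ L) {a₀ : ℝ} (ha₀ : 0 < a₀) :
    ∃ C δ : ℝ, 0 < C ∧ 0 < δ ∧ ∀ (K : ℕ), 1 ≤ K → ∀ (N : ℕ) [NeZero N], N = L ^ K → ∀ (e : ℕ) (M : Fin (d + 1) → ℕ) [∀ μ, NeZero (M μ)], (∀ μ, M μ = 2 * L ^ e) →
      ∀ (k : ℕ) (ι : Type) [Fintype ι] [DecidableEq ι],
        HasMaj (BlockNorm.ofBlocks (unitTorusGeo L k M) (liftBlk (blockOf N M) ι)) (BlockNorm.ofBlocks (unitTorusGeo L k M) (liftBlk (blockOf N M) ι)) (Matrix.mulVecLin (cGreen M N (fun (_ : Fin (d + 1)) (_ : Tor (fine N M)) => (1 : Matrix ι ι ℝ)) (aK a₀ (L : ℝ) K * (N : ℝ) ^ (d + 1)))) (fun y y' => C * Real.exp (-(δ * tdistT M y y'))) ∧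
        HasMaj (BlockNorm.ofBlocks (unitTorusGeo L k M) (liftBlk (blockOf N M) ι)) (BlockNorm.ofBlocks (unitTorusGeo L k M) (liftBlk (fun b : Tor (fine N M) × Fin (d + 1) => blockOf N M b.1) ι)) (Matrix.mulVecLin (cgrad M N (fun (_ : Fin (d + 1)) (_ : Tor (fine N M)) => (1 : Matrix ι ι ℝ)) * cGreen M N (fun (_ : Fin (d + 1)) (_ : Tor (fine N M)) => (1 : Matrix ι ι ℝ)) (aK a₀ (L : ℝ) K * (N : ℝ) ^ (d + 1)))) (fun y y' => C * Real.exp (-(δ * tdistT M y y'))) ∧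
        HasMaj (BlockNorm.ofBlocks (unitTorusGeo L k M) (liftBlk (fun b : Tor (fine N M) × Fin (d + 1) => blockOf N M b.1) ι)) (BlockNorm.ofBlocks (unitTorusGeo L k M) (liftBlk (blockOf N M) ι)) (Matrix.mulVecLin (cGreen M N (fun (_ : Fin (d + 1)) (_ : Tor (fine N M)) => (1 : Matrix ι ι ℝ)) (aK a₀ (L : ℝ) K * (N : ℝ) ^ (d + 1)) * (cgrad M N (fun (_ : Fin (d + 1)) (_ : Tor (fine N M)) => (1 : Matrix ι ι ℝ)))ᵀ)) (fun y y' => C * Real.exp (-(δ * tdistT M y y'))) := by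
  obtain ⟨C₀, δ₀, hC₀, hδ₀, H₀⟩ := fullPropOp_sup_decay (d := d) L hLodd hL ha₀ zero_le_one
  obtain ⟨C₁, δ₁, hC₁, hδ₁, H₁⟩ := fullPropDOp_sup_decay (d := d) L hLodd hL ha₀ zero_le_one
  obtain ⟨C₂, δ₂, hC₂, hδ₂, H₂⟩ := fullPropAdjOp_sup_decay (d := d) L hLodd hL ha₀ zero_le_one
  have hL1r : (1 : ℝ) < L := by exact_mod_cast (lt_of_lt_of_le one_lt_two hL)
  refine ⟨max (max C₀ C₁) (((d : ℝ) + 1) * C₂), min (min δ₀ δ₁) δ₂, lt_max_of_lt_left (lt_max_of_lt_left hC₀), lt_min (lt_min hδ₀ hδ₁) hδ₂, ?_⟩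
  intro K hK N _ hN e M _ hM k ι _ _
  have haK : 0 < aK a₀ (L : ℝ) K := aK_pos ha₀ hL1r hK
  -- the three massless scalar statements
  have hG : ∀ (lam : Tor (fine N M) → ℝ) (F D : ℝ), (∀ y, |lam y| ≤ F) → ∀ x : Tor (fine N M), (∀ y, lam y ≠ 0 → D ≤ tdistT M (blockOf N M x) (blockOf N M y)) →
      |((fineOp N M (aK a₀ (L : ℝ) K) (((N : ℕ) : ℝ) ^ 2) 0)⁻¹ *ᵥ lam) x| ≤ C₀ * Real.exp (-(δ₀ * D)) * F := fun lam F D hF x hD =>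
    abs_le_of_Ioc one_pos (continuousAt_fineOp_inv_mulVec_mass M N haK lam x) fun m2 hm2 hm2' => H₀ K hK N hN e M hM m2 hm2 hm2' lam F D hF x hD
  have hD : ∀ (μ : Fin (d + 1)) (lam : Tor (fine N M) → ℝ) (F D : ℝ), (∀ y, |lam y| ≤ F) → ∀ x : Tor (fine N M), (∀ y, lam y ≠ 0 → D ≤ tdistT M (blockOf N M x) (blockOf N M y)) →
      |(N : ℝ) * (((fineOp N M (aK a₀ (L : ℝ) K) (((N : ℕ) : ℝ) ^ 2) 0)⁻¹ *ᵥ lam) (x + unitVec (fine N M) μ) - ((fineOp N M (aK a₀ (L : ℝ) K) (((N : ℕ) : ℝ) ^ 2) 0)⁻¹ *ᵥ lam) x)| ≤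
        C₁ * Real.exp (-(δ₁ * D)) * F := fun μ lam F D hF x hD => by
    have hc : ContinuousAt (fun m2 : ℝ => (N : ℝ) * (((fineOp N M (aK a₀ (L : ℝ) K) (((N : ℕ) : ℝ) ^ 2) m2)⁻¹ *ᵥ lam) (x + unitVec (fine N M) μ) -
        ((fineOp N M (aK a₀ (L : ℝ) K) (((N : ℕ) : ℝ) ^ 2) m2)⁻¹ *ᵥ lam) x)) 0 :=
      continuousAt_const.mul ((continuousAt_fineOp_inv_mulVec_mass M N haK lam _).sub (continuousAt_fineOp_inv_mulVec_mass M N haK lam x))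
    exact abs_le_of_Ioc one_pos hc fun m2 hm2 hm2' => H₁ K hK N hN e M hM m2 hm2 hm2' μ lam F D hF x hD
  have hA : ∀ (ν : Fin (d + 1)) (lam : Tor (fine N M) → ℝ) (F D : ℝ), (∀ y, |lam y| ≤ F) → ∀ x : Tor (fine N M), (∀ y, lam y ≠ 0 → D ≤ tdistT M (blockOf N M x) (blockOf N M y)) →
      |((fineOp N M (aK a₀ (L : ℝ) K) (((N : ℕ) : ℝ) ^ 2) 0)⁻¹ *ᵥ (fun y => (N : ℝ) * (lam (y - unitVec (fine N M) ν) - lam y))) x| ≤ C₂ * Real.exp (-(δ₂ * D)) * F :=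
    fun ν lam F D hF x hD =>
      abs_le_of_Ioc one_pos (continuousAt_fineOp_inv_mulVec_mass M N haK _ x) fun m2 hm2 hm2' => H₂ K hK N hN e M hM m2 hm2 hm2' ν lam F D hF x hD
  -- constants
  set C : ℝ := max (max C₀ C₁) (((d : ℝ) + 1) * C₂) with hCdef
  set δ : ℝ := min (min δ₀ δ₁) δ₂ with hδdef
  have hC : 0 ≤ C := (hC₀.le.trans (le_max_left _ _)).trans (le_max_left _ _)
  have hmono : ∀ (c δ' : ℝ) (D : ℝ), 0 ≤ c → c ≤ C → δ ≤ δ' → 0 ≤ D → c * Real.exp (-(δ' * D)) ≤ C * Real.exp (-(δ * D)) := fun c δ' D hc hcC hδ' hD0 =>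
    mul_le_mul hcC (Real.exp_le_exp.mpr (by nlinarith)) (Real.exp_nonneg _) hC
  have hflat : cGreen M N (fun (_ : Fin (d + 1)) (_ : Tor (fine N M)) => (1 : Matrix ι ι ℝ)) (aK a₀ (L : ℝ) K * (N : ℝ) ^ (d + 1)) = (fineOp N M (aK a₀ (L : ℝ) K) (((N : ℕ) : ℝ) ^ 2) 0)⁻¹ ⊗ₖ (1 : Matrix ι ι ℝ) := by
    rw [cGreen_one, greenFlat_eq_fineOp_inv]
  refine ⟨?_, ?_, ?_⟩
  · -- entry 0
    rw [hflat, mulVecLin_kronecker_one_rect]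
    refine hasMaj_tensorId ι (fun y y' => by positivity) (hasMaj_of_kingDecay L k (blockOf N M) (blockOf N M) _ hC fun lam F D hF x hDx => ?_)
    have hF0 : 0 ≤ F := (abs_nonneg _).trans (hF x)
    rw [Matrix.mulVecLin_apply]
    rcases le_or_gt 0 D with hD0 | hD0
    · exact (hG lam F D hF x hDx).trans (mul_le_mul_of_nonneg_right (hmono C₀ δ₀ D hC₀.le ((le_max_left _ _).trans (le_max_left _ _)) ((min_le_left _ _).trans (min_le_left _ _)) hD0) hF0)
    · -- a negative `D` is weaker than `D = 0`
      have h0 := hG lam F 0 hF x (fun y _ => tdistT_nonneg M _ _)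
      refine h0.trans ?_
      rw [mul_zero, neg_zero, Real.exp_zero, mul_one]
      calc C₀ * F ≤ C * 1 * F := by nlinarith [(le_max_left C₀ C₁).trans (le_max_left _ (((d : ℝ) + 1) * C₂))]
        _ ≤ C * Real.exp (-(δ * D)) * F := mul_le_mul_of_nonneg_right (mul_le_mul_of_nonneg_left (Real.one_le_exp (by
            have : 0 < δ := lt_min (lt_min hδ₀ hδ₁) hδ₂; nlinarith)) hC) hF0
  · -- entry 1
    have hop : cgrad M N (fun (_ : Fin (d + 1)) (_ : Tor (fine N M)) => (1 : Matrix ι ι ℝ)) * cGreen M N (fun (_ : Fin (d + 1)) (_ : Tor (fine N M)) => (1 : Matrix ι ι ℝ)) (aK a₀ (L : ℝ) K * (N : ℝ) ^ (d + 1)) = (gradFlat M N * (fineOp N M (aK a₀ (L : ℝ) K) (((N : ℕ) : ℝ) ^ 2) 0)⁻¹) ⊗ₖ (1 : Matrix ι ι ℝ) := by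
      rw [hflat, cgrad_one, ← Matrix.mul_kronecker_mul, Matrix.mul_one]
    rw [hop, mulVecLin_kronecker_one_rect]
    refine hasMaj_tensorId ι (fun y y' => by positivity) (hasMaj_of_kingDecay L k (blockOf N M) (fun b : Tor (fine N M) × Fin (d + 1) => blockOf N M b.1) _ hC fun lam F D hF b hDx => ?_)
    have hF0 : 0 ≤ F := (abs_nonneg _).trans (hF b.1)
    rw [Matrix.mulVecLin_apply, ← Matrix.mulVec_mulVec]
    have hval : (gradFlat M N *ᵥ ((fineOp N M (aK a₀ (L : ℝ) K) (((N : ℕ) : ℝ) ^ 2) 0)⁻¹ *ᵥ lam)) b =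
        (N : ℝ) * (((fineOp N M (aK a₀ (L : ℝ) K) (((N : ℕ) : ℝ) ^ 2) 0)⁻¹ *ᵥ lam) (b.1 + unitVec (fine N M) b.2) - ((fineOp N M (aK a₀ (L : ℝ) K) (((N : ℕ) : ℝ) ^ 2) 0)⁻¹ *ᵥ lam) b.1) := by
      rw [Matrix.mulVec, dotProduct]
      simp only [gradFlat_apply]
      rw [show (∑ y : Tor (fine N M), (N : ℝ) * ((if y = b.1 + unitVec (fine N M) b.2 then (1 : ℝ) else 0) - (if b.1 = y then 1 else 0)) *
            ((fineOp N M (aK a₀ (L : ℝ) K) (((N : ℕ) : ℝ) ^ 2) 0)⁻¹ *ᵥ lam) y) =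
          ∑ y : Tor (fine N M), ((if y = b.1 + unitVec (fine N M) b.2 then (N : ℝ) * ((fineOp N M (aK a₀ (L : ℝ) K) (((N : ℕ) : ℝ) ^ 2) 0)⁻¹ *ᵥ lam) y else 0) -
            (if b.1 = y then (N : ℝ) * ((fineOp N M (aK a₀ (L : ℝ) K) (((N : ℕ) : ℝ) ^ 2) 0)⁻¹ *ᵥ lam) y else 0)) from
        Finset.sum_congr rfl fun y _ => by split_ifs <;> ring]
      rw [Finset.sum_sub_distrib, Finset.sum_ite_eq' Finset.univ, Finset.sum_ite_eq Finset.univ]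
      simp only [Finset.mem_univ, if_true]
      ring
    rw [hval]
    rcases le_or_gt 0 D with hD0 | hD0
    · exact (hD b.2 lam F D hF b.1 hDx).trans (mul_le_mul_of_nonneg_right (hmono C₁ δ₁ D hC₁.le ((le_max_right _ _).trans (le_max_left _ _)) ((min_le_left _ _).trans (min_le_right _ _)) hD0) hF0)
    · have h0 := hD b.2 lam F 0 hF b.1 (fun y _ => tdistT_nonneg M _ _)
      refine h0.trans ?_
      rw [mul_zero, neg_zero, Real.exp_zero, mul_one]
      calc C₁ * F ≤ C * 1 * F := by nlinarith [(le_max_right C₀ C₁).trans (le_max_left _ (((d : ℝ) + 1) * C₂))]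
        _ ≤ C * Real.exp (-(δ * D)) * F := mul_le_mul_of_nonneg_right (mul_le_mul_of_nonneg_left (Real.one_le_exp (by
            have : 0 < δ := lt_min (lt_min hδ₀ hδ₁) hδ₂; nlinarith)) hC) hF0
  · -- entry 2 (adjoint)
    have hop : cGreen M N (fun (_ : Fin (d + 1)) (_ : Tor (fine N M)) => (1 : Matrix ι ι ℝ)) (aK a₀ (L : ℝ) K * (N : ℝ) ^ (d + 1)) * (cgrad M N (fun (_ : Fin (d + 1)) (_ : Tor (fine N M)) => (1 : Matrix ι ι ℝ)))ᵀ = ((fineOp N M (aK a₀ (L : ℝ) K) (((N : ℕ) : ℝ) ^ 2) 0)⁻¹ * (gradFlat M N)ᵀ) ⊗ₖ (1 : Matrix ι ι ℝ) := by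
      rw [hflat, cgrad_one, ← Matrix.kroneckerMap_transpose, Matrix.transpose_one, ← Matrix.mul_kronecker_mul, Matrix.mul_one]
    rw [hop, mulVecLin_kronecker_one_rect]
    refine hasMaj_tensorId ι (fun y y' => by positivity) (hasMaj_of_kingDecay L k (fun b : Tor (fine N M) × Fin (d + 1) => blockOf N M b.1) (blockOf N M) _ hC fun ω F D hF x hDx => ?_)
    have hF0 : 0 ≤ F := (abs_nonneg _).trans (hF (x, 0))
    rw [Matrix.mulVecLin_apply, ← Matrix.mulVec_mulVec]
    have hsrc : (gradFlat M N)ᵀ *ᵥ ω = ∑ ν : Fin (d + 1), fun z => (N : ℝ) * (ω (z - unitVec (fine N M) ν, ν) - ω (z, ν)) := by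
      funext z; rw [gradFlat_transpose_mulVec, Finset.sum_apply]
    rw [hsrc, Matrix.mulVec_sum, Finset.sum_apply]
    have hterm : ∀ ν : Fin (d + 1), |((fineOp N M (aK a₀ (L : ℝ) K) (((N : ℕ) : ℝ) ^ 2) 0)⁻¹ *ᵥ fun z => (N : ℝ) * (ω (z - unitVec (fine N M) ν, ν) - ω (z, ν))) x| ≤
        C₂ * Real.exp (-(δ * D)) * F := by
      intro ν
      rcases le_or_gt 0 D with hD0 | hD0
      · refine (hA ν (fun z => ω (z, ν)) F D (fun z => hF (z, ν)) x fun z hz => hDx (z, ν) hz).trans ?_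
        exact mul_le_mul_of_nonneg_right (mul_le_mul_of_nonneg_left (Real.exp_le_exp.mpr (by nlinarith [min_le_right (min δ₀ δ₁) δ₂])) hC₂.le) hF0
      · have h0 := hA ν (fun z => ω (z, ν)) F 0 (fun z => hF (z, ν)) x (fun y _ => tdistT_nonneg M _ _)
        refine h0.trans ?_
        rw [mul_zero, neg_zero, Real.exp_zero, mul_one]
        exact mul_le_mul_of_nonneg_right (le_mul_of_one_le_right hC₂.le (Real.one_le_exp (by
          have : 0 < δ := lt_min (lt_min hδ₀ hδ₁) hδ₂; nlinarith))) hF0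
    calc |∑ ν : Fin (d + 1), ((fineOp N M (aK a₀ (L : ℝ) K) (((N : ℕ) : ℝ) ^ 2) 0)⁻¹ *ᵥ fun z => (N : ℝ) * (ω (z - unitVec (fine N M) ν, ν) - ω (z, ν))) x|
        ≤ ∑ ν : Fin (d + 1), C₂ * Real.exp (-(δ * D)) * F := (Finset.abs_sum_le_sum_abs _ _).trans (Finset.sum_le_sum fun ν _ => hterm ν)
      _ = ((d : ℝ) + 1) * C₂ * Real.exp (-(δ * D)) * F := by rw [Finset.sum_const, Finset.card_univ, Fintype.card_fin, nsmul_eq_mul]; push_cast; ring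
      _ ≤ C * Real.exp (-(δ * D)) * F := mul_le_mul_of_nonneg_right (mul_le_mul_of_nonneg_right (le_max_right _ _) (Real.exp_nonneg _)) hF0

end Rows

end Summit.QuantumFields.YangMills.BalabanUVNodes.N15.CovLandau

end
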